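import Literature.NumberTheory.LFunctions.Zhang2022.Section8DipoleSuperposition
import Literature.NumberTheory.LFunctions.Zhang2022.SkeletonLemma84Rel
import HarnessLib

/-!
# Zhang (2022) §8: the anti-side (A)-world MASS RULE for superposed weights — Lemma 8.4's twisted Riesz mean
# `Σ_{n<y} χ(n)ξ₀ⱼ(n;d,r)n⁻¹(y/n)^{−β_μ}log(y/n) = L′(1,χ)Π(d,r)𝔤_{jμ}(y) + O(…)` SUPERPOSED:
# `Σ_n χ(n)ξ₀ⱼ(n;d,r)n⁻¹W(z_n) = (log P)⁻¹L′Π·[Σ_i c_i𝔤(ζ_i) + ∫σ𝔤] + (transferred errors)`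

Topic `Literature/NumberTheory/LFunctions/Zhang2022` (Landau–Siegel audit tree; verdict-neutral). Y. Zhang, *Discrete mean
estimates and the Landau–Siegel zero*, arXiv:2211.02515v1 (2022) [Zhang2022LandauSiegel] — **an unrefereed manuscript
under adjudication; nothing here asserts or denies its Theorems 1–2; no claim about Landau–Siegel zeros.** Cell
landau-siegel §D, crux K0 = stmt-Parity-20459, prover ls-knife-K0-p1 g0. Companion of `Section8DipoleSuperposition`
(the ψ-side, LEMMA A); this is the anti-side engine («LEMMA A*» of K1″a DISPLAY #5 §1, the mass rule), as a pure
SUPERPOSITION TRANSFER: the kernel of Lemma 8.4 is the TWISTED ramp `(ζ − z)₊e^{−γ(ζ−z)}` (`γ = β_μ log P`), and a weight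

  `W(z) = Σ_i c_i (ζ_i − z)₊e^{−γ(ζ_i−z)} + ∫₀^Z (y − z)₊e^{−γ(y−z)} σ(y) dy`

turns the `n`-sum of Prop 7.1's `S_j` into the same superposition of twisted Riesz means (`sum_twSuperposed_eq`, exact).
The pointwise evaluation of the twisted Riesz mean (the tree's `Skeleton.Lemma84Rel c′`, a THEOREM of the tree —
`Lemma84.lemma84Rel_of_lemma83Rel` + `AppendixA.lemma83Rel_holds`) is consumed here as a HYPOTHESIS at the fixed modulus
(`hE`: `‖R^ξ(e^{yΛ}) − L′Π𝔤(y)‖ ≤ E` on `[τ, Z]`), and the low range `[0, τ]` (`e^{τΛ} = T`, where Lemma 8.4 is silent) as a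
crude bound (`hB`; the caller gets it from `XiZeroTailMean.xiZeroTailMean`): `xiDipole_superposed` is then the estimate
`‖Σ_n χξ n⁻¹W(z_n) − Λ⁻¹L′Π·(Σc_i𝔤(ζ_i) + ∫σ𝔤)‖ ≤ Λ⁻¹[E·(Σ‖c_i‖ + ∫‖σ‖) + τ·S·B]`. The identification of
`Σc_i𝔤(ζ_i) + ∫σ𝔤` with DISPLAY #5's mass rule `−W′(0)/Λ + (β′+β″)W(0) + β′β″Λ∫W` is the caller's Taylor bookkeeping (for a
single twisted atom it is the algebraic identity `𝔤_{jμ}(e^{a}) = (1 − aβ_μ)e^{−β_μa} + (β′+β″)ae^{−β_μa} +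
β′β″[−ae^{−β_μa}/β_μ + (1 − e^{−β_μa})/β_μ²]`, checked by hand in the seat's notes; not needed here).

## Contents
* `xiRieszMean` (the sum of Lemma 8.4 / `Skeleton.Lemma84Rel`, literally), `tramp` (twisted ramp), `sum_tramp_eq_xiRieszMean`
  (one atom = one twisted Riesz mean), `twSuperposedWeight`, `sum_twSuperposed_eq` (exact superposition identity),
  `continuousOn_xiRieszMean_exp`, `xiDipole_superposed` (the transfer estimate).

## References
* Y. Zhang, arXiv:2211.02515v1 (2022), §8 Lemmas 8.3–8.4, (8.9), pp. 16–17; §7 p. 13 (`ξ₀ⱼ`).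
  [cite: Zhang2022LandauSiegel, §8 Lemma 8.4]
-/

noncomputable section

open Complex Real Finset MeasureTheory intervalIntegral Set

namespace Literature.NumberTheory.LFunctions.Zhang2022.DipoleRule

open Skeleton

variable (c' : ℝ) {D : ℕ} [NeZero D] (χ : DirichletCharacter ℂ D)

/-! ### The twisted Riesz mean of `χ(n)ξ₀ⱼ(n;d,r)/n` -/

/-- **The twisted Riesz mean of Lemma 8.4**: `R^ξ(y) = Σ_{1≤n<⌈y⌉} χ(n)ξ₀ⱼ(n;d,r)n⁻¹(y/n)^{−β_μ}log(y/n)` — literally the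
sum of `Skeleton.Lemma84Rel`. [cite: Zhang2022LandauSiegel, §8 Lemma 8.4] -/
def xiRieszMean (j μ d r : ℕ) (y : ℝ) : ℂ :=
  ∑ n ∈ Finset.Ico 1 ⌈y⌉₊, χ (n : ZMod D) * xiZero c' D j n d r / (n : ℂ) *
    ((y / n : ℝ) : ℂ) ^ (-betaMu D μ) * (Real.log (y / n) : ℂ)

/-- **The twisted ramp atom** `(ζ − z)₊·e^{−γ(ζ − z)}` (`γ = β_μ·log P`): in the variable `z = log n/Λ` it is Lemma 8.4's
kernel `(y/n)^{−β_μ}log(y/n)/Λ` at `y = e^{ζΛ}`. [cite: Zhang2022LandauSiegel, §8 Lemma 8.4] -/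
def tramp (γ : ℂ) (ζ z : ℝ) : ℂ := (ramp ζ z : ℂ) * Complex.exp (-(γ * ((ζ - z : ℝ) : ℂ)))

/-- `tramp` is continuous in the kink height. [cite: Zhang2022LandauSiegel, §8 Lemma 8.4] -/
theorem continuous_tramp_left (γ : ℂ) (z : ℝ) : Continuous fun ζ => tramp γ ζ z := by
  unfold tramp
  refine (Complex.continuous_ofReal.comp (continuous_ramp_left z)).mul ?_
  exact Complex.continuous_exp.comp ((continuous_const.mul
    (Complex.continuous_ofReal.comp (continuous_id.sub continuous_const))).neg)

variable {c' χ}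

omit [NeZero D] in
/-- **One twisted atom is one twisted Riesz mean:** for `Λ > 0` and `⌈e^{ζΛ}⌉ ≤ N`,
`Σ_{1≤n<N} χ(n)ξ₀ⱼ(n;d,r)n⁻¹·tramp (β_μΛ) ζ (log n/Λ) = Λ⁻¹·R^ξ(e^{ζΛ})`. [cite: Zhang2022LandauSiegel, §8 Lemma 8.4] -/
theorem sum_tramp_eq_xiRieszMean {Λ ζ : ℝ} (hΛ : 0 < Λ) (j μ d r : ℕ) {N : ℕ} (hN : ⌈Real.exp (ζ * Λ)⌉₊ ≤ N) :
    ∑ n ∈ Finset.Ico 1 N, χ (n : ZMod D) * xiZero c' D j n d r / (n : ℂ) *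
        tramp (betaMu D μ * Λ) ζ (Real.log n / Λ)
      = (Λ : ℂ)⁻¹ * xiRieszMean c' χ j μ d r (Real.exp (ζ * Λ)) := by
  set x : ℝ := Real.exp (ζ * Λ) with hx
  have hx0 : 0 < x := Real.exp_pos _
  have hΛ0 : (Λ : ℂ) ≠ 0 := by exact_mod_cast hΛ.ne'
  have h1N : 1 ≤ ⌈x⌉₊ := Nat.one_le_iff_ne_zero.mpr (Nat.pos_iff_ne_zero.mp (Nat.ceil_pos.mpr hx0))
  rw [← Finset.sum_Ico_consecutive _ h1N hN]
  have htail : ∑ n ∈ Finset.Ico ⌈x⌉₊ N, χ (n : ZMod D) * xiZero c' D j n d r / (n : ℂ) *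
      tramp (betaMu D μ * Λ) ζ (Real.log n / Λ) = 0 := by
    refine Finset.sum_eq_zero fun n hn => ?_
    rw [Finset.mem_Ico] at hn
    have hnx : x ≤ n := (Nat.le_ceil x).trans (by exact_mod_cast hn.1)
    have hn0 : (0 : ℝ) < n := lt_of_lt_of_le hx0 hnx
    have hlog : ζ * Λ ≤ Real.log n := by
      rw [← Real.log_exp (ζ * Λ)]; exact Real.log_le_log hx0 hnx
    have hr : ramp ζ (Real.log n / Λ) = 0 := by
      unfold ramp; apply max_eq_right; rw [sub_nonpos, le_div_iff₀ hΛ]; exact hlog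
    simp [tramp, hr]
  rw [htail, add_zero]
  unfold xiRieszMean
  rw [Finset.mul_sum]
  refine Finset.sum_congr rfl fun n hn => ?_
  rw [Finset.mem_Ico] at hn
  have hn1 : (1 : ℝ) ≤ n := by exact_mod_cast hn.1
  have hn0 : (0 : ℝ) < n := by linarith
  have hnx : (n : ℝ) < x := by
    have : (n : ℝ) ≤ (⌈x⌉₊ : ℝ) - 1 := by
      have h := hn.2; have : (n : ℝ) + 1 ≤ ⌈x⌉₊ := by exact_mod_cast h
      linarith
    linarith [Nat.ceil_lt_add_one hx0.le]
  have hxn : 0 < x / n := div_pos hx0 hn0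
  have hlogxn : Real.log (x / n) = ζ * Λ - Real.log n := by rw [Real.log_div hx0.ne' hn0.ne', hx, Real.log_exp]
  have hlog : Real.log n ≤ ζ * Λ := by
    rw [← Real.log_exp (ζ * Λ)]; exact Real.log_le_log hn0 hnx.le
  have hr : ramp ζ (Real.log n / Λ) = Real.log (x / n) / Λ := by
    unfold ramp
    rw [max_eq_left (by rw [sub_nonneg, div_le_iff₀ hΛ]; exact hlog), hlogxn]
    field_simp
  have hpow : ((x / n : ℝ) : ℂ) ^ (-betaMu D μ) = Complex.exp (-(betaMu D μ * Λ * ((ζ - Real.log n / Λ : ℝ) : ℂ))) := by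
    rw [Complex.cpow_def_of_ne_zero (by exact_mod_cast hxn.ne'), ← Complex.ofReal_log hxn.le, hlogxn]
    congr 1
    push_cast
    field_simp
  unfold tramp
  rw [hr, hpow]
  push_cast
  field_simp

/-- **A twisted superposed weight**: atoms `c_i` at heights `ζ_i` and a density `σ` on `[0,Z]`, against the twisted
ramp `tramp γ`. [cite: Zhang2022LandauSiegel, §8 Lemma 8.4] -/
def twSuperposedWeight (γ : ℂ) {n : ℕ} (c : Fin n → ℂ) (ζ : Fin n → ℝ) (Z : ℝ) (σ : ℝ → ℂ) (z : ℝ) : ℂ :=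
  ∑ i, c i * tramp γ (ζ i) z + ∫ y in (0:ℝ)..Z, tramp γ y z * σ y

omit [NeZero D] in
/-- **The exact superposition identity (anti-side):** for `Λ > 0`, `0 ≤ Z`, atoms with `ζ_i ≤ Z`, `σ` integrable on
`[0,Z]`: `Σ_{1≤n<⌈e^{ZΛ}⌉} χ(n)ξ₀ⱼ(n;d,r)n⁻¹·W(log n/Λ) = Λ⁻¹·[Σ_i c_i R^ξ(e^{ζ_iΛ}) + ∫₀^Z R^ξ(e^{yΛ})σ(y)dy]` for the
twisted superposed weight `W` with `γ = β_μΛ`. [cite: Zhang2022LandauSiegel, §8 Lemma 8.4] -/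
theorem sum_twSuperposed_eq {Λ Z : ℝ} (hΛ : 0 < Λ) (hZ : 0 ≤ Z) (j μ d r : ℕ) {n : ℕ} (c : Fin n → ℂ)
    (ζ : Fin n → ℝ) (hζ : ∀ i, ζ i ≤ Z) {σ : ℝ → ℂ} (hσ : IntervalIntegrable σ volume 0 Z) :
    ∑ m ∈ Finset.Ico 1 ⌈Real.exp (Z * Λ)⌉₊, χ (m : ZMod D) * xiZero c' D j m d r / (m : ℂ) *
        twSuperposedWeight (betaMu D μ * Λ) c ζ Z σ (Real.log m / Λ)
      = (Λ : ℂ)⁻¹ * (∑ i, c i * xiRieszMean c' χ j μ d r (Real.exp (ζ i * Λ))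
          + ∫ y in (0:ℝ)..Z, xiRieszMean c' χ j μ d r (Real.exp (y * Λ)) * σ y) := by
  set N : ℕ := ⌈Real.exp (Z * Λ)⌉₊ with hN
  set γ : ℂ := betaMu D μ * Λ with hγ
  set w : ℕ → ℂ := fun m => χ (m : ZMod D) * xiZero c' D j m d r / (m : ℂ) with hw
  have hmono : ∀ {y : ℝ}, y ≤ Z → ⌈Real.exp (y * Λ)⌉₊ ≤ N := fun hy =>
    Nat.ceil_le_ceil (Real.exp_le_exp.mpr (mul_le_mul_of_nonneg_right hy hΛ.le))
  have hsplit : ∀ m : ℕ, w m * twSuperposedWeight γ c ζ Z σ (Real.log m / Λ)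
      = (∑ i, c i * (w m * tramp γ (ζ i) (Real.log m / Λ)))
        + ∫ y in (0:ℝ)..Z, w m * (tramp γ y (Real.log m / Λ) * σ y) := by
    intro m
    unfold twSuperposedWeight
    rw [mul_add, Finset.mul_sum, ← intervalIntegral.integral_const_mul]
    congr 1
    refine Finset.sum_congr rfl fun i _ => ?_
    ring
  show ∑ m ∈ Finset.Ico 1 N, w m * twSuperposedWeight γ c ζ Z σ (Real.log m / Λ) = _
  simp_rw [hsplit]
  rw [Finset.sum_add_distrib, Finset.sum_comm]
  have hatoms : ∑ i, ∑ m ∈ Finset.Ico 1 N, c i * (w m * tramp γ (ζ i) (Real.log m / Λ))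
      = ∑ i, c i * xiRieszMean c' χ j μ d r (Real.exp (ζ i * Λ)) * (Λ : ℂ)⁻¹ := by
    refine Finset.sum_congr rfl fun i _ => ?_
    rw [← Finset.mul_sum]
    show c i * ∑ m ∈ Finset.Ico 1 N, χ (m : ZMod D) * xiZero c' D j m d r / (m : ℂ) * tramp γ (ζ i) (Real.log m / Λ) = _
    rw [hγ, sum_tramp_eq_xiRieszMean hΛ j μ d r (hmono (hζ i))]
    ring
  have hint : ∀ m ∈ Finset.Ico 1 N, IntervalIntegrable
      (fun y => w m * (tramp γ y (Real.log m / Λ) * σ y)) volume 0 Z := by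
    intro m _
    exact (hσ.continuousOn_mul (continuous_tramp_left γ _).continuousOn).const_mul _
  have hdens : ∑ m ∈ Finset.Ico 1 N, ∫ y in (0:ℝ)..Z, w m * (tramp γ y (Real.log m / Λ) * σ y)
      = ∫ y in (0:ℝ)..Z, xiRieszMean c' χ j μ d r (Real.exp (y * Λ)) * σ y * (Λ : ℂ)⁻¹ := by
    rw [← intervalIntegral.integral_finsetSum hint]
    refine intervalIntegral.integral_congr fun y hy => ?_
    rw [Set.uIcc_of_le hZ] at hy
    have hsum : ∑ m ∈ Finset.Ico 1 N, w m * (tramp γ y (Real.log m / Λ) * σ y)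
        = (∑ m ∈ Finset.Ico 1 N, w m * tramp γ y (Real.log m / Λ)) * σ y := by
      rw [Finset.sum_mul]
      refine Finset.sum_congr rfl fun m _ => ?_
      ring
    have hatom : ∑ m ∈ Finset.Ico 1 N, w m * tramp γ y (Real.log m / Λ)
        = (Λ : ℂ)⁻¹ * xiRieszMean c' χ j μ d r (Real.exp (y * Λ)) := by
      rw [hγ]; exact sum_tramp_eq_xiRieszMean hΛ j μ d r (hmono hy.2)
    simp only [hsum, hatom]
    ring
  rw [hatoms, hdens, ← Finset.sum_mul, intervalIntegral.integral_mul_const]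
  ring

omit [NeZero D] in
/-- `y ↦ R^ξ(e^{yΛ})` is continuous on `[0,Z]` (a finite sum of twisted ramps there). [cite: Zhang2022LandauSiegel, §8 Lemma 8.4] -/
theorem continuousOn_xiRieszMean_exp {Λ Z : ℝ} (hΛ : 0 < Λ) (j μ d r : ℕ) :
    ContinuousOn (fun y => xiRieszMean c' χ j μ d r (Real.exp (y * Λ))) (Icc 0 Z) := by
  set N : ℕ := ⌈Real.exp (Z * Λ)⌉₊ with hN
  have hΛ0 : (Λ : ℂ) ≠ 0 := by exact_mod_cast hΛ.ne'
  have heq : EqOn (fun y => xiRieszMean c' χ j μ d r (Real.exp (y * Λ)))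
      (fun y => (Λ : ℂ) * ∑ m ∈ Finset.Ico 1 N, χ (m : ZMod D) * xiZero c' D j m d r / (m : ℂ) *
        tramp (betaMu D μ * Λ) y (Real.log m / Λ)) (Icc 0 Z) := by
    intro y hy
    have hmono : ⌈Real.exp (y * Λ)⌉₊ ≤ N :=
      Nat.ceil_le_ceil (Real.exp_le_exp.mpr (mul_le_mul_of_nonneg_right hy.2 hΛ.le))
    simp only [sum_tramp_eq_xiRieszMean hΛ j μ d r hmono]
    field_simp
  refine ContinuousOn.congr ?_ heq
  refine continuousOn_const.mul (continuousOn_finsetSum _ fun m _ => ?_)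
  exact (continuousOn_const.mul (continuous_tramp_left _ _).continuousOn)

/-! ### The transfer estimate -/

omit [NeZero D] in
/-- **THE MASS-RULE TRANSFER FOR SUPERPOSED WEIGHTS (fixed modulus).** Let `Λ > 0`, `0 < τ ≤ Z`; let `G : ℝ → ℂ` be the
main-term profile (the caller takes `G(y) = 𝔤_{jμ}(e^{yΛ})`, `Skeleton.frakgW`) continuous on `[0,Z]`, `M ∈ ℂ` the main
constant (`L′(1,χ)Π(d,r)`), and suppose the twisted Riesz mean satisfies POINTWISE `‖R^ξ(e^{yΛ}) − M·G(y)‖ ≤ E` for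
`y ∈ [τ,Z]` (Lemma 8.4, `Skeleton.Lemma84Rel`, on `[T,P]`) and `‖R^ξ(e^{yΛ}) − M·G(y)‖ ≤ B` for `y ∈ [0,τ]` (crude). Then for
a twisted superposed weight with atoms at heights `τ ≤ ζ_i ≤ Z`, density `σ` integrable on `[0,Z]`, `‖σ‖ ≤ S` on `[0,τ]`:
`‖Σ_{n<⌈e^{ZΛ}⌉} χ(n)ξ₀ⱼn⁻¹W(z_n) − Λ⁻¹M(Σ_i c_iG(ζ_i) + ∫₀^Z G σ)‖ ≤ Λ⁻¹[E(Σ‖c_i‖ + ∫₀^Z‖σ‖) + τSB]`.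
[cite: Zhang2022LandauSiegel, §8 Lemma 8.4] -/
theorem xiDipole_superposed {Λ Z τ S E B : ℝ} {M : ℂ} {G : ℝ → ℂ} (hΛ : 0 < Λ) (hτ : 0 < τ) (hτZ : τ ≤ Z)
    (j μ d r : ℕ) {n : ℕ} (c : Fin n → ℂ) (ζ : Fin n → ℝ) (hζ : ∀ i, τ ≤ ζ i ∧ ζ i ≤ Z) {σ : ℝ → ℂ}
    (hσ : IntervalIntegrable σ volume 0 Z) (hS : ∀ y ∈ Icc (0 : ℝ) τ, ‖σ y‖ ≤ S)
    (hG : ContinuousOn G (Icc 0 Z))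
    (hE : ∀ y ∈ Icc τ Z, ‖xiRieszMean c' χ j μ d r (Real.exp (y * Λ)) - M * G y‖ ≤ E)
    (hB : ∀ y ∈ Icc (0 : ℝ) τ, ‖xiRieszMean c' χ j μ d r (Real.exp (y * Λ)) - M * G y‖ ≤ B) :
    ‖(∑ m ∈ Finset.Ico 1 ⌈Real.exp (Z * Λ)⌉₊, χ (m : ZMod D) * xiZero c' D j m d r / (m : ℂ) *
        twSuperposedWeight (betaMu D μ * Λ) c ζ Z σ (Real.log m / Λ))
        - (Λ : ℂ)⁻¹ * M * (∑ i, c i * G (ζ i) + ∫ y in (0:ℝ)..Z, G y * σ y)‖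
      ≤ Λ⁻¹ * (E * (∑ i, ‖c i‖ + ∫ y in (0:ℝ)..Z, ‖σ y‖) + τ * S * B) := by
  have hZ0 : 0 ≤ Z := hτ.le.trans hτZ
  have hS0 : 0 ≤ S := (norm_nonneg _).trans (hS 0 ⟨le_rfl, hτ.le⟩)
  have hE0 : 0 ≤ E := (norm_nonneg _).trans (hE τ ⟨le_rfl, hτZ⟩)
  set R : ℝ → ℂ := fun y => xiRieszMean c' χ j μ d r (Real.exp (y * Λ)) with hR
  have hRc : ContinuousOn R (Icc 0 Z) := continuousOn_xiRieszMean_exp hΛ j μ d r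
  rw [sum_twSuperposed_eq hΛ hZ0 j μ d r c ζ (fun i => (hζ i).2) hσ]
  -- rewrite the difference
  have hi1 : IntervalIntegrable (fun y => R y * σ y) volume 0 Z := by
    refine hσ.continuousOn_mul ?_; rw [Set.uIcc_of_le hZ0]; exact hRc
  have hi2 : IntervalIntegrable (fun y => M * G y * σ y) volume 0 Z := by
    refine hσ.continuousOn_mul ?_; rw [Set.uIcc_of_le hZ0]; exact continuousOn_const.mul hG
  have hkey : (Λ : ℂ)⁻¹ * (∑ i, c i * R (ζ i) + ∫ y in (0:ℝ)..Z, R y * σ y)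
        - (Λ : ℂ)⁻¹ * M * (∑ i, c i * G (ζ i) + ∫ y in (0:ℝ)..Z, G y * σ y)
      = (Λ : ℂ)⁻¹ * ((∑ i, c i * (R (ζ i) - M * G (ζ i))) + ∫ y in (0:ℝ)..Z, (R y - M * G y) * σ y) := by
    have hsub : (∫ y in (0:ℝ)..Z, (R y - M * G y) * σ y)
        = (∫ y in (0:ℝ)..Z, R y * σ y) - M * ∫ y in (0:ℝ)..Z, G y * σ y := by
      rw [← intervalIntegral.integral_const_mul, ← intervalIntegral.integral_sub hi1 (by
        simpa only [mul_assoc] using hi2)]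
      refine intervalIntegral.integral_congr fun y _ => ?_
      ring
    have hs : ∑ i, c i * (R (ζ i) - M * G (ζ i)) = (∑ i, c i * R (ζ i)) - M * ∑ i, c i * G (ζ i) := by
      simp only [mul_sub, Finset.sum_sub_distrib, Finset.mul_sum]
      congr 1
      refine Finset.sum_congr rfl fun i _ => ?_
      ring
    rw [hsub, hs]
    ring
  rw [hkey, norm_mul, norm_inv, Complex.norm_real, Real.norm_eq_abs, abs_of_pos hΛ]
  refine mul_le_mul_of_nonneg_left ?_ (inv_nonneg.mpr hΛ.le)
  -- atoms
  have hat : ‖∑ i, c i * (R (ζ i) - M * G (ζ i))‖ ≤ E * ∑ i, ‖c i‖ := by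
    calc ‖∑ i, c i * (R (ζ i) - M * G (ζ i))‖ ≤ ∑ i, ‖c i * (R (ζ i) - M * G (ζ i))‖ := norm_sum_le _ _
      _ ≤ ∑ i, ‖c i‖ * E := by
          refine Finset.sum_le_sum fun i _ => ?_
          rw [norm_mul]
          exact mul_le_mul_of_nonneg_left (hE (ζ i) ⟨(hζ i).1, (hζ i).2⟩) (norm_nonneg _)
      _ = E * ∑ i, ‖c i‖ := by rw [← Finset.sum_mul]; ring
  -- density, split at τ
  have hdens : ‖∫ y in (0:ℝ)..Z, (R y - M * G y) * σ y‖
      ≤ E * (∫ y in (0:ℝ)..Z, ‖σ y‖) + τ * S * B := by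
    set F : ℝ → ℂ := fun y => (R y - M * G y) * σ y with hF
    have hRGc : ContinuousOn (fun y => R y - M * G y) (Set.uIcc 0 Z) := by
      rw [Set.uIcc_of_le hZ0]; exact hRc.sub (continuousOn_const.mul hG)
    have hFi : IntervalIntegrable F volume 0 Z := hσ.continuousOn_mul hRGc
    have hsub01 : Set.uIcc (0 : ℝ) τ ⊆ Set.uIcc 0 Z := by
      rw [Set.uIcc_of_le hτ.le, Set.uIcc_of_le hZ0]; exact Set.Icc_subset_Icc_right hτZ
    have hsubτZ : Set.uIcc τ Z ⊆ Set.uIcc 0 Z := by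
      rw [Set.uIcc_of_le hτZ, Set.uIcc_of_le hZ0]; exact Set.Icc_subset_Icc_left hτ.le
    have hF1 : IntervalIntegrable F volume 0 τ := hFi.mono_set hsub01
    have hF2 : IntervalIntegrable F volume τ Z := hFi.mono_set hsubτZ
    rw [← intervalIntegral.integral_add_adjacent_intervals hF1 hF2]
    have hlowI : ‖∫ y in (0:ℝ)..τ, F y‖ ≤ B * S * |τ - 0| := by
      refine intervalIntegral.norm_integral_le_of_norm_le_const fun y hy => ?_
      rw [Set.uIoc_of_le hτ.le] at hy
      rw [hF, norm_mul]
      have hB0 : 0 ≤ B := (norm_nonneg _).trans (hB y ⟨hy.1.le, hy.2⟩)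
      exact mul_le_mul (hB y ⟨hy.1.le, hy.2⟩) (hS y ⟨hy.1.le, hy.2⟩) (norm_nonneg _) hB0
    have hσn : IntervalIntegrable (fun y => E * ‖σ y‖) volume τ Z := (hσ.norm.mono_set hsubτZ).const_mul E
    have hhighI : ‖∫ y in τ..Z, F y‖ ≤ ∫ y in τ..Z, E * ‖σ y‖ := by
      refine intervalIntegral.norm_integral_le_of_norm_le hτZ ?_ hσn
      refine Filter.Eventually.of_forall fun y hy => ?_
      rw [hF, norm_mul]
      exact mul_le_mul_of_nonneg_right (hE y ⟨hy.1.le, hy.2⟩) (norm_nonneg _)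
    have hsplitσ : (∫ y in (0:ℝ)..Z, ‖σ y‖) = (∫ y in (0:ℝ)..τ, ‖σ y‖) + ∫ y in τ..Z, ‖σ y‖ :=
      (intervalIntegral.integral_add_adjacent_intervals (hσ.norm.mono_set hsub01) (hσ.norm.mono_set hsubτZ)).symm
    have hσ0τ : 0 ≤ ∫ y in (0:ℝ)..τ, ‖σ y‖ := intervalIntegral.integral_nonneg hτ.le fun y _ => norm_nonneg _
    have hhigh' : (∫ y in τ..Z, E * ‖σ y‖) ≤ E * ∫ y in (0:ℝ)..Z, ‖σ y‖ := by
      rw [intervalIntegral.integral_const_mul, hsplitσ, mul_add]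
      have : 0 ≤ E * ∫ y in (0:ℝ)..τ, ‖σ y‖ := mul_nonneg hE0 hσ0τ
      linarith
    calc ‖(∫ y in (0:ℝ)..τ, F y) + ∫ y in τ..Z, F y‖ ≤ ‖∫ y in (0:ℝ)..τ, F y‖ + ‖∫ y in τ..Z, F y‖ := norm_add_le _ _
      _ ≤ B * S * |τ - 0| + E * ∫ y in (0:ℝ)..Z, ‖σ y‖ := add_le_add hlowI (hhighI.trans hhigh')
      _ = E * (∫ y in (0:ℝ)..Z, ‖σ y‖) + τ * S * B := by rw [sub_zero, abs_of_pos hτ]; ring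
  calc ‖(∑ i, c i * (R (ζ i) - M * G (ζ i))) + ∫ y in (0:ℝ)..Z, (R y - M * G y) * σ y‖
      ≤ ‖∑ i, c i * (R (ζ i) - M * G (ζ i))‖ + ‖∫ y in (0:ℝ)..Z, (R y - M * G y) * σ y‖ := norm_add_le _ _
    _ ≤ E * ∑ i, ‖c i‖ + (E * (∫ y in (0:ℝ)..Z, ‖σ y‖) + τ * S * B) := add_le_add hat hdens
    _ = E * (∑ i, ‖c i‖ + ∫ y in (0:ℝ)..Z, ‖σ y‖) + τ * S * B := by ring

end Literature.NumberTheory.LFunctions.Zhang2022.DipoleRule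

end
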